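import Literature.NumberTheory.Automorphic.UnboundedDenominatorsProofs
import HarnessLib

/-!
# The unbounded denominators theorem (Calegari–Dimitrov–Tang) — §4.2: the common level group `G_N`

Sibling of `Literature/NumberTheory/Automorphic/UnboundedDenominators.lean` (the named fact
`CalegariDimitrovTang2025_unboundedDenominators`) and of `UnboundedDenominatorsProofs.lean` (CDT §4.1
in hypothesis form: Wohlfahrt level, normal core, `diag(p, 1)`-conjugation). PROOF-ONLY file: no
definition, no named fact (D-0026).

Source: F. Calegari, V. Dimitrov, Y. Tang, *The unbounded denominators conjecture*, J. Amer. Math.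
Soc. **38** (2025), 627–702 = arXiv:2109.09040, §4.2, Lemma 4.2.3 (arXiv v1: Lemma 24), last
sentence and its proof, verbatim (v1): "The space `R_N` is invariant under a normal finite index
subgroup `G_N ⊂ ⟨E, Γ(N)⟩ ⊂ SL₂(ℤ)` containing `E` with `L(G_N) = N`. […] Since `R_N` is finite over
`M_2`, it is generated by a finite number of basis elements each of which is invariant under some
finite index subgroup `G ⊂ SL₂(ℤ)` containing `E` with `L(G)` dividing `N`. The intersection of all
these groups still has finite index and level `N` by Lemma 4.1.2, and then we take `G_N` to be the
largest normal subgroup of `SL₂(ℤ)` contained in this intersection, which also has `L(G_N) = N` by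
Lemma 4.1.3."

## What is proved

The GROUP-THEORETIC half of that sentence, for an arbitrary finite family `G : ι → Subgroup SL(2, ℤ)`
of finite-index subgroups containing `E = {±1}` whose Wohlfahrt levels divide `N` (hypothesis form
"every conjugate of `Tᴺ` lies in `G i`", = `wohlfahrtLevel (G i) ∣ N` by `wohlfahrtLevel_dvd_iff`):
the normal core `G_N` of `(⨅ i, G i) ∩ ±Γ(N)` is normal, of finite index, contains `-1`, is
contained in every `G i` and in `±Γ(N)` (every element is `±γ` with `γ ∈ Γ(N)`), contains every
conjugate of `Tᴺ`, and has Wohlfahrt level EXACTLY `N`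
(`exists_commonLevelSubgroup_of_forall_conj_T_pow_mem`, printed-level form
`exists_commonLevelSubgroup_of_wohlfahrtLevel_dvd`). These are precisely the binders of the core case
`CalegariDimitrovTang2025_unboundedDenominators.iff_core_wohlfahrtLevel`
(`UnboundedDenominatorsReductions.lean`): `G` normal of finite index, `-1 ∈ G`,
`G ⊆ ±Γ(L(G))`. The intersection with `±Γ(N)` realises CDT's "`G_N ⊂ ⟨E, Γ(N)⟩`" (in the paper it
comes for free because `M_N ⊂ R_N` puts `⟨E, Γ(N)⟩` among the groups). The FIELD-THEORETIC half of
Lemma 4.2.3 (finite generation of `R_N` over `M_2`, by the holonomy bound) is not addressed here.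

Also recorded: a finite-index subgroup of `±Γ(N)` containing all conjugates of `Tᴺ` has Wohlfahrt
level exactly `N` (`wohlfahrtLevel_eq_of_forall_mem_or_neg_mem_Gamma`).

## References

* [CalegariDimitrovTang2025] F. Calegari, V. Dimitrov, Y. Tang, The unbounded denominators
  conjecture, J. Amer. Math. Soc. 38 (2025), no. 3, 627–702; arXiv:2109.09040. §4.2, Lemma 4.2.3
  (arXiv v1 Lemma 24) and its proof; Lemmas 4.1.2, 4.1.3.
-/

noncomputable section

namespace Literature.NumberTheory.Automorphic

open scoped MatrixGroups
open Matrix.SpecialLinearGroup CongruenceSubgroup ModularGroup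

/-! ### Bookkeeping about `±Γ(N)` -/

/-- `-1` lies in the normal core of any subgroup of `SL(2, ℤ)` containing it (`-1` is central).
[folklore] -/
private theorem neg_one_mem_normalCore {H : Subgroup SL(2, ℤ)} (h : (-1 : SL(2, ℤ)) ∈ H) :
    (-1 : SL(2, ℤ)) ∈ H.normalCore := by
  intro b
  simpa only [mul_neg, mul_one, neg_mul, mul_inv_cancel] using h

/-- `Tᴺ ∈ Γ(N)` (natural exponent). [folklore] -/
private theorem T_pow_mem_Gamma_self (N : ℕ) : T ^ N ∈ Gamma N := by
  have h := CongruenceSubgroup.ModularGroup_T_pow_mem_Gamma N N dvd_rfl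
  rwa [Int.natAbs_natCast, zpow_natCast] at h

/-- Every conjugate of `Tᴺ` lies in `Γ(N)` (`Γ(N)` is normal). [folklore] -/
private theorem conj_T_pow_mem_Gamma (N : ℕ) (g : SL(2, ℤ)) : g * T ^ N * g⁻¹ ∈ Gamma N :=
  (Gamma_normal N).conj_mem _ (T_pow_mem_Gamma_self N) g

/-- If `Tᴸ ∈ ±Γ(N)`, i.e. `Tᴸ ∈ Γ(N)` or `-Tᴸ ∈ Γ(N)`, then `N ∣ L` (read off the upper-right
entry `±L`). This is why a subgroup of `±Γ(N)` containing all conjugates of `Tᴺ` has Wohlfahrt level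
exactly `N`. [folklore] -/
private theorem dvd_of_T_pow_mem_or_neg_T_pow_mem_Gamma {N L : ℕ}
    (h : T ^ L ∈ Gamma N ∨ -(T ^ L) ∈ Gamma N) : N ∣ L := by
  rcases h with h | h
  · rw [← zpow_natCast, Gamma_mem, ModularGroup.coe_T_zpow] at h
    obtain ⟨-, h01, -, -⟩ := h
    simp only [Matrix.of_apply, Matrix.cons_val', Matrix.cons_val_zero, Matrix.cons_val_one,
      Matrix.cons_val_fin_one, Matrix.empty_val', Int.cast_natCast] at h01
    exact (ZMod.natCast_eq_zero_iff L N).mp h01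
  · rw [← zpow_natCast, Gamma_mem] at h
    obtain ⟨-, h01, -, -⟩ := h
    rw [Matrix.SpecialLinearGroup.coe_neg, ModularGroup.coe_T_zpow] at h01
    simp only [Matrix.neg_apply, Matrix.of_apply, Matrix.cons_val', Matrix.cons_val_zero,
      Matrix.cons_val_one, Matrix.cons_val_fin_one, Matrix.empty_val', Int.cast_neg,
      Int.cast_natCast, neg_eq_zero] at h01
    exact (ZMod.natCast_eq_zero_iff L N).mp h01

/-- A finite-index subgroup of `±Γ(N)` (every element `±γ`, `γ ∈ Γ(N)`) containing every conjugate of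
`Tᴺ` has Wohlfahrt level exactly `N`. [cite: CalegariDimitrovTang2025, proof of Lemma 4.2.3] -/
theorem wohlfahrtLevel_eq_of_forall_mem_or_neg_mem_Gamma {G : Subgroup SL(2, ℤ)} [G.FiniteIndex]
    {N : ℕ} (hle : ∀ γ ∈ G, γ ∈ Gamma N ∨ -γ ∈ Gamma N)
    (hT : ∀ g : SL(2, ℤ), g * T ^ N * g⁻¹ ∈ G) : wohlfahrtLevel G = N :=
  Nat.dvd_antisymm ((wohlfahrtLevel_dvd_iff G N).mpr hT)
    (dvd_of_T_pow_mem_or_neg_T_pow_mem_Gamma (hle _ (T_pow_wohlfahrtLevel_mem G)))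

/-! ### The common level group `G_N` (CDT Lemma 4.2.3) -/

/-- **CDT Lemma 4.2.3, group-theoretic part** [cite: CalegariDimitrovTang2025, Lemma 4.2.3
(arXiv v1: Lemma 24), last sentence and its proof]. Let `N ≠ 0` and let `G : ι → Subgroup SL(2, ℤ)`
be a FINITE family of finite-index subgroups, each containing `E = {±1}` and each containing every
conjugate of `Tᴺ` ("`L(G i) ∣ N`"). Then there is a subgroup `G_N ≤ SL(2, ℤ)` — the normal core of
`(⋂ᵢ G i) ∩ ±Γ(N)` — which is normal, of finite index, contains `-1`, is contained in every `G i`,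
is contained in `±Γ(N)` (every element is `γ` or `-γ` with `γ ∈ Γ(N)`; CDT: "`G_N ⊂ ⟨E, Γ(N)⟩`"),
contains every conjugate of `Tᴺ`, and has Wohlfahrt level exactly `N` (CDT: "still has finite index
and level `N` by Lemma 4.1.2 … the largest normal subgroup … also has `L(G_N) = N` by Lemma 4.1.3").
So every function invariant under some `G i` is invariant under `G_N`, and `G_N` has exactly the
shape of the groups of the core case
`CalegariDimitrovTang2025_unboundedDenominators.iff_core_wohlfahrtLevel`. -/
theorem exists_commonLevelSubgroup_of_forall_conj_T_pow_mem {ι : Type*} [Finite ι] {N : ℕ}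
    (hN : N ≠ 0) (G : ι → Subgroup SL(2, ℤ)) [hG : ∀ i, (G i).FiniteIndex]
    (hneg : ∀ i, (-1 : SL(2, ℤ)) ∈ G i) (hT : ∀ i (g : SL(2, ℤ)), g * T ^ N * g⁻¹ ∈ G i) :
    ∃ (GN : Subgroup SL(2, ℤ)) (_ : GN.FiniteIndex), GN.Normal ∧ (-1 : SL(2, ℤ)) ∈ GN ∧
      (∀ i, GN ≤ G i) ∧ (∀ γ ∈ GN, γ ∈ Gamma N ∨ -γ ∈ Gamma N) ∧
      (∀ g : SL(2, ℤ), g * T ^ N * g⁻¹ ∈ GN) ∧ wohlfahrtLevel GN = N := by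
  haveI : NeZero N := ⟨hN⟩
  -- `±Γ(N)` as a subgroup
  let PM : Subgroup SL(2, ℤ) :=
    { carrier := {γ | γ ∈ Gamma N ∨ -γ ∈ Gamma N}
      mul_mem' := fun {a b} ha hb ↦ by
        simp only [Set.mem_setOf_eq] at ha hb ⊢
        rcases ha with ha | ha <;> rcases hb with hb | hb
        · exact Or.inl (mul_mem ha hb)
        · exact Or.inr (by rw [show -(a * b) = a * -b by rw [mul_neg]]; exact mul_mem ha hb)
        · exact Or.inr (by rw [show -(a * b) = -a * b by rw [neg_mul]]; exact mul_mem ha hb)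
        · exact Or.inl (by rw [show a * b = -a * -b by rw [neg_mul_neg]]; exact mul_mem ha hb)
      one_mem' := Or.inl (one_mem _)
      inv_mem' := fun {a} ha ↦ by
        simp only [Set.mem_setOf_eq] at ha ⊢
        rcases ha with ha | ha
        · exact Or.inl (inv_mem ha)
        · exact Or.inr (by rw [show -a⁻¹ = (-a)⁻¹ by rw [neg_inv]]; exact inv_mem ha) }
  have hmemPM : ∀ γ, γ ∈ PM ↔ γ ∈ Gamma N ∨ -γ ∈ Gamma N := fun γ ↦ Iff.rfl
  have hΓPM : Gamma N ≤ PM := fun γ hγ ↦ Or.inl hγ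
  haveI hPMfi : PM.FiniteIndex := Subgroup.finiteIndex_of_le hΓPM
  -- the intersection `H = (⋂ G i) ∩ ±Γ(N)` and its normal core
  haveI hIfi : (⨅ i, G i).FiniteIndex := Subgroup.finiteIndex_iInf hG
  let H : Subgroup SL(2, ℤ) := (⨅ i, G i) ⊓ PM
  haveI hHfi : H.FiniteIndex := inferInstance
  have hHT : ∀ g : SL(2, ℤ), g * T ^ N * g⁻¹ ∈ H := fun g ↦
    ⟨Subgroup.mem_iInf.mpr fun i ↦ hT i g, Or.inl (conj_T_pow_mem_Gamma N g)⟩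
  have hHneg : (-1 : SL(2, ℤ)) ∈ H :=
    ⟨Subgroup.mem_iInf.mpr hneg, Or.inr (by rw [neg_neg]; exact one_mem _)⟩
  refine ⟨H.normalCore, inferInstance, inferInstance, neg_one_mem_normalCore hHneg,
    fun i ↦ H.normalCore_le.trans (inf_le_left.trans (iInf_le _ i)), fun γ hγ ↦ ?_,
    conj_T_pow_mem_normalCore_of_forall_conj_T_pow_mem hHT, ?_⟩
  · exact (hmemPM γ).mp (Subgroup.mem_inf.mp (H.normalCore_le hγ)).2
  · exact wohlfahrtLevel_eq_of_forall_mem_or_neg_mem_Gamma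
      (fun γ hγ ↦ (hmemPM γ).mp (Subgroup.mem_inf.mp (H.normalCore_le hγ)).2)
      (conj_T_pow_mem_normalCore_of_forall_conj_T_pow_mem hHT)

/-- **CDT Lemma 4.2.3, group-theoretic part, printed-level form**
[cite: CalegariDimitrovTang2025, Lemma 4.2.3 (arXiv v1: Lemma 24)]: the same with the hypothesis
"`L(G i) ∣ N`" stated through the tree's `wohlfahrtLevel` (CDT Definition 4.1.1) and the conclusion
`L(G_N) = N`. -/
theorem exists_commonLevelSubgroup_of_wohlfahrtLevel_dvd {ι : Type*} [Finite ι] {N : ℕ}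
    (hN : N ≠ 0) (G : ι → Subgroup SL(2, ℤ)) [∀ i, (G i).FiniteIndex]
    (hneg : ∀ i, (-1 : SL(2, ℤ)) ∈ G i) (hL : ∀ i, wohlfahrtLevel (G i) ∣ N) :
    ∃ (GN : Subgroup SL(2, ℤ)) (_ : GN.FiniteIndex), GN.Normal ∧ (-1 : SL(2, ℤ)) ∈ GN ∧
      (∀ i, GN ≤ G i) ∧ (∀ γ ∈ GN, γ ∈ Gamma N ∨ -γ ∈ Gamma N) ∧
      wohlfahrtLevel GN = N :=
  by
  obtain ⟨GN, hfi, hn, hneg', hle, hpm, -, hw⟩ :=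
    exists_commonLevelSubgroup_of_forall_conj_T_pow_mem hN G hneg
      fun i ↦ (wohlfahrtLevel_dvd_iff (G i) N).mp (hL i)
  exact ⟨GN, hfi, hn, hneg', hle, hpm, hw⟩

/-- **The case of a single group** (the shape in which the final assembly uses it: a modular form on
ANY finite-index `G ∋ -1` of Wohlfahrt level dividing `N` is a modular form on a group of the core
case). For `G` of finite index with `-1 ∈ G` and all conjugates of `Tᴺ` in `G` (`N ≠ 0`) there is a
normal finite-index `G_N ≤ G` with `-1 ∈ G_N ⊆ ±Γ(N)` and `L(G_N) = N`.
[cite: CalegariDimitrovTang2025, Lemma 4.2.3 (arXiv v1: Lemma 24)] -/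
theorem exists_normal_le_of_forall_conj_T_pow_mem {N : ℕ} (hN : N ≠ 0) (G : Subgroup SL(2, ℤ))
    [G.FiniteIndex] (hneg : (-1 : SL(2, ℤ)) ∈ G) (hT : ∀ g : SL(2, ℤ), g * T ^ N * g⁻¹ ∈ G) :
    ∃ (GN : Subgroup SL(2, ℤ)) (_ : GN.FiniteIndex), GN.Normal ∧ (-1 : SL(2, ℤ)) ∈ GN ∧
      GN ≤ G ∧ (∀ γ ∈ GN, γ ∈ Gamma N ∨ -γ ∈ Gamma N) ∧
      (∀ g : SL(2, ℤ), g * T ^ N * g⁻¹ ∈ GN) ∧ wohlfahrtLevel GN = N := by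
  obtain ⟨GN, hfi, hn, hneg', hle, hpm, hT', hw⟩ :=
    exists_commonLevelSubgroup_of_forall_conj_T_pow_mem hN (fun _ : Unit ↦ G) (fun _ ↦ hneg)
      fun _ ↦ hT
  exact ⟨GN, hfi, hn, hneg', hle (), hpm, hT', hw⟩

/-- **Two levels.** For finite-index `G₁, G₂ ∋ -1` with `L(G₁) ∣ N`, `L(G₂) ∣ N` (`N ≠ 0`), a common
normal finite-index subgroup `G_N ≤ G₁ ⊓ G₂` with `-1 ∈ G_N ⊆ ±Γ(N)`, `L(G_N) = N` — the form used
for the product of two generators of `R_N` ("`gh` is invariant under `G ∩ H` … Lemma 4.1.2").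
[cite: CalegariDimitrovTang2025, proof of Lemma 4.2.3 (arXiv v1: Lemma 24)] -/
theorem exists_normal_le_inf_of_forall_conj_T_pow_mem {N : ℕ} (hN : N ≠ 0)
    (G₁ G₂ : Subgroup SL(2, ℤ)) [G₁.FiniteIndex] [G₂.FiniteIndex]
    (h₁ : (-1 : SL(2, ℤ)) ∈ G₁) (h₂ : (-1 : SL(2, ℤ)) ∈ G₂)
    (hT₁ : ∀ g : SL(2, ℤ), g * T ^ N * g⁻¹ ∈ G₁) (hT₂ : ∀ g : SL(2, ℤ), g * T ^ N * g⁻¹ ∈ G₂) :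
    ∃ (GN : Subgroup SL(2, ℤ)) (_ : GN.FiniteIndex), GN.Normal ∧ (-1 : SL(2, ℤ)) ∈ GN ∧
      GN ≤ G₁ ⊓ G₂ ∧ (∀ γ ∈ GN, γ ∈ Gamma N ∨ -γ ∈ Gamma N) ∧
      (∀ g : SL(2, ℤ), g * T ^ N * g⁻¹ ∈ GN) ∧ wohlfahrtLevel GN = N := by
  haveI : ∀ b : Bool, (cond b G₁ G₂).FiniteIndex := fun b ↦ by cases b <;> assumption
  obtain ⟨GN, hfi, hn, hneg', hle, hpm, hT', hw⟩ :=
    exists_commonLevelSubgroup_of_forall_conj_T_pow_mem hN (fun b : Bool ↦ cond b G₁ G₂)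
      (fun b ↦ by cases b <;> assumption) (fun b ↦ by cases b <;> assumption)
  exact ⟨GN, hfi, hn, hneg', le_inf (hle true) (hle false), hpm, hT', hw⟩

end Literature.NumberTheory.Automorphic

end
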